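import Mathlib
import Summits.ValiantsHypothesis.ValiantsHypothesis.Theorems.GrenetZeonTwoDimCoefficientsDefs
import Summits.ValiantsHypothesis.ValiantsHypothesis.Theorems.GrenetZeonTwoDimCoefficientsStubClassify
import Summits.ValiantsHypothesis.ValiantsHypothesis.Theorems.GrenetZeonTwoDimCoefficientsPerThreeDimTwo

/-!
# Crux `GrenetZeon.TwoDimCoefficients` (stmt-ValiantsHypothesis-8062): the hypothesis `HasDim2Repr`
# IS "split or dual" — the converse of `stub_classify`

`stub_classify` (p577200) proves `HasDim2Repr n m → SplitRepr n m ∨ DualRepr n m`.  This file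
supplies the converse, so that the crux's hypothesis is literally the disjunction of the two shapes
the line `dim2_cases` works with:

* `hasDim2Repr_of_splitRepr` — `per_n = α det A + β det B` is an `(m, ≤ 2)`-representation over
  `R = ℂ × ℂ`: the affine matrix `(1,0)·A + (0,1)·B` over `R[x]` has determinant `(det A, det B)`
  coefficientwise, read through `l(a, b) = αa + βb`.
* (`hasDim2Repr_of_dualRepr` is in `…PerThreeDimTwo.lean`: `R = ℂ[ε]`, Jacobi.)
* `hasDim2Repr_iff_split_or_dual : HasDim2Repr n m ↔ SplitRepr n m ∨ DualRepr n m`.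

Consequence for planners: re-typing the crux over `SplitRepr ∨ DualRepr` (or over the disjunctive
form of `…LinearForm.lean`) loses nothing.  HONEST FRAMING: definitional bookkeeping; `VP ≠ VNP`
is not moved.
-/

-- single-conjunct layout `Summits/ValiantsHypothesis/ValiantsHypothesis`: the duplicated namespace
-- component is mandated by the tree.
set_option linter.dupNamespace false

noncomputable section

namespace Summit.ValiantsHypothesis.ValiantsHypothesis.Cruxes.TwoDimCoefficients.DimTwoCases

open Literature.Computability.AlgebraicComplexity Matrix MvPolynomial

variable {n m : ℕ}

/-- **The split shape is an `(m, ≤ 2)`-representation over `ℂ × ℂ`.** [folklore] -/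
theorem hasDim2Repr_of_splitRepr (h : SplitRepr n m) : HasDim2Repr n m := by
  obtain ⟨α, β, A, B, hA, hB, hper⟩ := h
  -- the diagonal embedding `ℂ → ℂ × ℂ` and the two idempotents
  let δ : ℂ →+* ℂ × ℂ := (RingHom.id ℂ).prod (RingHom.id ℂ)
  let ι : MvPolynomial (Fin n × Fin n) ℂ →+* MvPolynomial (Fin n × Fin n) (ℂ × ℂ) :=
    MvPolynomial.map δ
  let e₁ : MvPolynomial (Fin n × Fin n) (ℂ × ℂ) := MvPolynomial.C ((1 : ℂ), (0 : ℂ))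
  let e₂ : MvPolynomial (Fin n × Fin n) (ℂ × ℂ) := MvPolynomial.C ((0 : ℂ), (1 : ℂ))
  let A' : Matrix (Fin m) (Fin m) (MvPolynomial (Fin n × Fin n) (ℂ × ℂ)) :=
    e₁ • ι.mapMatrix A + e₂ • ι.mapMatrix B
  let l : (ℂ × ℂ) →ₗ[ℂ] ℂ := α • LinearMap.fst ℂ ℂ ℂ + β • LinearMap.snd ℂ ℂ ℂ
  -- the two projections recover `A` and `B`
  let π₁ : MvPolynomial (Fin n × Fin n) (ℂ × ℂ) →+* MvPolynomial (Fin n × Fin n) ℂ :=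
    MvPolynomial.map (RingHom.fst ℂ ℂ)
  let π₂ : MvPolynomial (Fin n × Fin n) (ℂ × ℂ) →+* MvPolynomial (Fin n × Fin n) ℂ :=
    MvPolynomial.map (RingHom.snd ℂ ℂ)
  have hδ₁ : (RingHom.fst ℂ ℂ).comp δ = RingHom.id ℂ := RingHom.ext fun _ => rfl
  have hδ₂ : (RingHom.snd ℂ ℂ).comp δ = RingHom.id ℂ := RingHom.ext fun _ => rfl
  have hπ₁ι : ∀ p, π₁ (ι p) = p := by
    intro p
    change MvPolynomial.map (RingHom.fst ℂ ℂ) (MvPolynomial.map δ p) = p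
    rw [MvPolynomial.map_map, hδ₁, MvPolynomial.map_id]
  have hπ₂ι : ∀ p, π₂ (ι p) = p := by
    intro p
    change MvPolynomial.map (RingHom.snd ℂ ℂ) (MvPolynomial.map δ p) = p
    rw [MvPolynomial.map_map, hδ₂, MvPolynomial.map_id]
  have hπ₁e₁ : π₁ e₁ = 1 := by
    change MvPolynomial.map (RingHom.fst ℂ ℂ) (MvPolynomial.C ((1 : ℂ), (0 : ℂ))) = 1
    rw [MvPolynomial.map_C]; exact MvPolynomial.C_1
  have hπ₁e₂ : π₁ e₂ = 0 := by
    change MvPolynomial.map (RingHom.fst ℂ ℂ) (MvPolynomial.C ((0 : ℂ), (1 : ℂ))) = 0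
    rw [MvPolynomial.map_C]; exact MvPolynomial.C_0
  have hπ₂e₁ : π₂ e₁ = 0 := by
    change MvPolynomial.map (RingHom.snd ℂ ℂ) (MvPolynomial.C ((1 : ℂ), (0 : ℂ))) = 0
    rw [MvPolynomial.map_C]; exact MvPolynomial.C_0
  have hπ₂e₂ : π₂ e₂ = 1 := by
    change MvPolynomial.map (RingHom.snd ℂ ℂ) (MvPolynomial.C ((0 : ℂ), (1 : ℂ))) = 1
    rw [MvPolynomial.map_C]; exact MvPolynomial.C_1
  have hπ₁A : π₁.mapMatrix A' = A := by
    refine Matrix.ext fun i j => ?_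
    simp only [A', RingHom.mapMatrix_apply, Matrix.map_apply, Matrix.add_apply, Matrix.smul_apply,
      smul_eq_mul, map_add, map_mul, hπ₁ι, hπ₁e₁, hπ₁e₂, one_mul, zero_mul, add_zero]
  have hπ₂A : π₂.mapMatrix A' = B := by
    refine Matrix.ext fun i j => ?_
    simp only [A', RingHom.mapMatrix_apply, Matrix.map_apply, Matrix.add_apply, Matrix.smul_apply,
      smul_eq_mul, map_add, map_mul, hπ₂ι, hπ₂e₁, hπ₂e₂, one_mul, zero_mul, zero_add]
  have hfst : ∀ d, (coeff d A'.det).1 = coeff d A.det := by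
    intro d
    have h := MvPolynomial.coeff_map (RingHom.fst ℂ ℂ) A'.det d
    change coeff d (π₁ A'.det) = RingHom.fst ℂ ℂ (coeff d A'.det) at h
    rw [RingHom.map_det, hπ₁A] at h
    exact h.symm
  have hsnd : ∀ d, (coeff d A'.det).2 = coeff d B.det := by
    intro d
    have h := MvPolynomial.coeff_map (RingHom.snd ℂ ℂ) A'.det d
    change coeff d (π₂ A'.det) = RingHom.snd ℂ ℂ (coeff d A'.det) at h
    rw [RingHom.map_det, hπ₂A] at h
    exact h.symm
  refine ⟨ℂ × ℂ, inferInstance, inferInstance, inferInstance, ?_, l, A', ?_, ?_⟩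
  · rw [Module.finrank_prod, Module.finrank_self]
  · intro i j
    simp only [A', Matrix.add_apply, Matrix.smul_apply, RingHom.mapMatrix_apply, Matrix.map_apply,
      smul_eq_mul]
    refine (totalDegree_add _ _).trans (max_le ?_ ?_)
    · refine (totalDegree_mul _ _).trans ?_
      rw [totalDegree_C, zero_add]
      exact (totalDegree_map_le _ _).trans (hA i j)
    · refine (totalDegree_mul _ _).trans ?_
      rw [totalDegree_C, zero_add]
      exact (totalDegree_map_le _ _).trans (hB i j)
  · intro d
    simp only [l, LinearMap.add_apply, LinearMap.smul_apply, LinearMap.fst_apply,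
      LinearMap.snd_apply, smul_eq_mul, hfst, hsnd]
    rw [hper, coeff_add, coeff_C_mul, coeff_C_mul]

/-- **`HasDim2Repr` is exactly "split or dual"** (`stub_classify` and its converse). [folklore] -/
theorem hasDim2Repr_iff_split_or_dual : HasDim2Repr n m ↔ SplitRepr n m ∨ DualRepr n m :=
  ⟨stub_classify n m, fun h => h.elim hasDim2Repr_of_splitRepr hasDim2Repr_of_dualRepr⟩

end Summit.ValiantsHypothesis.ValiantsHypothesis.Cruxes.TwoDimCoefficients.DimTwoCases

end
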